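import Literature.Computability.Complexity.BranchingProgramEntropy
import Summits.PneNP.PneNP.Theorems.SzkEntropyPeaThreeNotInPSocketRawDefs
import Literature.Computability.Complexity.PEAToPED
import Literature.Computability.Complexity.CodeFPListKit
import HarnessLib

/-!
# Route SzkEntropy, crux `PeaThreeNotInP` (stmt-PneNP-10776), line `SketchIdeator3`, socket rider:
# the instance map `PEDBP → PED 3` (stubs `stub_toPED_mem`, `stub_toPEDRawFP`)

Dvir–Gutfreund–Rothblum–Vadhan, Thm 4.6 (the `PED` side): a pair of branching-program samplers
`(p, q) = ((n, Bs), (n', Bs'))` is sent to the pair of sparse cubic maps obtained by replacing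
each sampler by the tree's degree-3 perfect randomized encoding (`encodeBDDsMap`, entropy
`H(f) + m` with `m` random bits, `entropy_encodeBDDsMap`; degree `3`, `degLE_three_encodeBDDsMap`)
and PADDING each side with the identity map on as many fresh variables as the OTHER side's
randomness (`PolyMapF2.prod`, `PolyMapF2.idMap`, `entropy_prod`, `entropy_idMap`), so that both
entropies are shifted by the same amount `m + m'` and the entropy difference is preserved
exactly: YES ↦ YES and NO ↦ NO of `PED 3` (`stub_toPED_mem`).

The raw form `toPEDRaw` of the map (plain nested lists of naturals, the format of the `CodeFP`
kit; `prodRaw`, `idMapRaw` are the raw forms of `PolyMapF2.prod`, `PolyMapF2.idMap`) is typed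
polynomial time on the codes of the instances GIVEN a `CodeFP` program for the raw list encoding
`encodeBDDsRaw` (`stub_toPEDRawFP`; the identity map on `m'` variables is written with the output list of
the side it pads for as unary budget — the range of a binary numeral alone is not polynomial —
which is long enough: every block has more outputs than fresh variables,
`fst_encodeBDDsRaw_le_length`).

References: Z. Dvir, D. Gutfreund, G. N. Rothblum, S. Vadhan, *On approximating the entropy of
polynomial mappings*, ECCC TR10-160 (2010) / ICS 2011, Thm 4.6, Claim 4.4, §3 p. 6;
B. Applebaum, Y. Ishai, E. Kushilevitz, SIAM J. Comput. 36 (2006), Lemma 4.15;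
S. Arora, B. Barak, *Computational Complexity*, CUP 2009, §1.3.
-/

namespace Summit.PneNP.PneNP.Cruxes.PeaThreeNotInP.SocketBP

set_option linter.dupNamespace false -- `Summit.PneNP.PneNP.…`: summit = sub-problem name (D-0017)

open Literature.Computability.Complexity Literature.Computability.Complexity.RandPoly
open Literature.Computability.Cryptography (freshBDDs encodeBDDsMap)
open CodeFP (natE pairE rawE listE)

/-! ### The raw instance map -/

/-- Raw direct product of two sparse maps, the second re-indexed by `N + ·` (the raw form of
`PolyMapF2.prod` on `N + N'` variables: `Fin.castAdd` keeps the value, `Fin.natAdd N` adds `N`).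
[cite: DvirGutfreundRothblumVadhan2010, §3 p.6] -/
def prodRaw (N : ℕ) (P Q : List (List (List ℕ))) : List (List (List ℕ)) := P ++ Q.map (List.map (List.map fun i => N + i))

/-- The raw identity map on `m` variables: output `i` is the single monomial `xᵢ` (the raw form
of `PolyMapF2.idMap m`). [cite: DvirGutfreundRothblumVadhan2010, §3 p.6] -/
def idMapRaw (m : ℕ) : List (List (List ℕ)) := (List.range m).map fun i => [[i]]

/-- **The raw instance map `PEDBP → PED 3`**: `((n, Bs), (n', Bs')) ↦ ((N + m', P × id_{m'}),
(N' + m, P' × id_m))` with `(N, P) = encodeBDDsRaw n n Bs`, `m = N - n` (and primed), i.e. each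
side's degree-3 encoding padded with the identity map on the other side's number of random bits.
[cite: DvirGutfreundRothblumVadhan2010, Thm 4.6] -/
def toPEDRaw (c : (ℕ × List (List (ℕ × ℕ × ℕ × ℕ))) × (ℕ × List (List (ℕ × ℕ × ℕ × ℕ)))) : (ℕ × List (List (List ℕ))) × (ℕ × List (List (List ℕ))) :=
    (((encodeBDDsRaw c.1.1 c.1.1 c.1.2).1 + ((encodeBDDsRaw c.2.1 c.2.1 c.2.2).1 - c.2.1),
      prodRaw (encodeBDDsRaw c.1.1 c.1.1 c.1.2).1 (encodeBDDsRaw c.1.1 c.1.1 c.1.2).2 (idMapRaw ((encodeBDDsRaw c.2.1 c.2.1 c.2.2).1 - c.2.1))),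
     ((encodeBDDsRaw c.2.1 c.2.1 c.2.2).1 + ((encodeBDDsRaw c.1.1 c.1.1 c.1.2).1 - c.1.1),
      prodRaw (encodeBDDsRaw c.2.1 c.2.1 c.2.2).1 (encodeBDDsRaw c.2.1 c.2.1 c.2.2).2 (idMapRaw ((encodeBDDsRaw c.1.1 c.1.1 c.1.2).1 - c.1.1))))

/-- **The instance map `PEDBP → PED 3`** (DGRV Thm 4.6): each sampler is replaced by its
degree-3 perfect randomized encoding, padded with the identity map on as many fresh variables
as the other sampler's encoding has random bits. [cite: DvirGutfreundRothblumVadhan2010, Thm 4.6] -/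
def toPED (I : PEDBPInst) : PEDInst :=
    (⟨I.1.1 + freshBDDs (compileAll I.1.1 I.1.2) + freshBDDs (compileAll I.2.1 I.2.2),
      (encodeBDDsMap I.1.1 (compileAll I.1.1 I.1.2)).prod (PolyMapF2.idMap (freshBDDs (compileAll I.2.1 I.2.2)))⟩,
     ⟨I.2.1 + freshBDDs (compileAll I.2.1 I.2.2) + freshBDDs (compileAll I.1.1 I.1.2),
      (encodeBDDsMap I.2.1 (compileAll I.2.1 I.2.2)).prod (PolyMapF2.idMap (freshBDDs (compileAll I.1.1 I.1.2)))⟩)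

/-! ### Semantics: entropy bookkeeping and degrees (`stub_toPED_mem`) -/

/-- The first map of the image has entropy `H(p) + m + m'`.
[cite: DvirGutfreundRothblumVadhan2010, Claim 4.4] -/
theorem entropy_toPED_fst (I : PEDBPInst) :
    (toPED I).1.2.entropy = bpEntropy I.1.1 I.1.2 + freshBDDs (compileAll I.1.1 I.1.2) +
      freshBDDs (compileAll I.2.1 I.2.2) := by
  show ((encodeBDDsMap I.1.1 (compileAll I.1.1 I.1.2)).prod
    (PolyMapF2.idMap (freshBDDs (compileAll I.2.1 I.2.2)))).entropy = _
  rw [PolyMapF2.entropy_prod, PolyMapF2.entropy_idMap]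
  have h : (encodeBDDsMap I.1.1 (compileAll I.1.1 I.1.2)).entropy =
      bpEntropy I.1.1 I.1.2 + freshBDDs (compileAll I.1.1 I.1.2) :=
    Literature.Computability.Cryptography.entropy_encodeBDDsMap _ _
  rw [h]

/-- The second map of the image has entropy `H(q) + m' + m`.
[cite: DvirGutfreundRothblumVadhan2010, Claim 4.4] -/
theorem entropy_toPED_snd (I : PEDBPInst) :
    (toPED I).2.2.entropy = bpEntropy I.2.1 I.2.2 + freshBDDs (compileAll I.2.1 I.2.2) +
      freshBDDs (compileAll I.1.1 I.1.2) := by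
  show ((encodeBDDsMap I.2.1 (compileAll I.2.1 I.2.2)).prod
    (PolyMapF2.idMap (freshBDDs (compileAll I.1.1 I.1.2)))).entropy = _
  rw [PolyMapF2.entropy_prod, PolyMapF2.entropy_idMap]
  have h : (encodeBDDsMap I.2.1 (compileAll I.2.1 I.2.2)).entropy =
      bpEntropy I.2.1 I.2.2 + freshBDDs (compileAll I.2.1 I.2.2) :=
    Literature.Computability.Cryptography.entropy_encodeBDDsMap _ _
  rw [h]

/-- The first map of the image has degree `≤ 3`. [cite: DvirGutfreundRothblumVadhan2010, Thm 4.5] -/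
theorem degLE_toPED_fst (I : PEDBPInst) : (toPED I).1.2.DegLE 3 :=
  (Literature.Computability.Cryptography.degLE_three_encodeBDDsMap _ _).prod
    (PolyMapF2.degLE_idMap (by norm_num) _)

/-- The second map of the image has degree `≤ 3`. [cite: DvirGutfreundRothblumVadhan2010, Thm 4.5] -/
theorem degLE_toPED_snd (I : PEDBPInst) : (toPED I).2.2.DegLE 3 :=
  (Literature.Computability.Cryptography.degLE_three_encodeBDDsMap _ _).prod
    (PolyMapF2.degLE_idMap (by norm_num) _)

/-- **`toPED` maps YES to YES and NO to NO** (`PEDBP` versus `PED 3`): both entropies are shifted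
by the same `m + m'`, so `H(q) + 1 ≤ H(p)` and `H(p) + 1 ≤ H(q)` are preserved, and all maps
have degree `≤ 3`. [cite: DvirGutfreundRothblumVadhan2010, Thm 4.6] -/
theorem stub_toPED_mem : (∀ I : PEDBPInst, PEDBPInst.encoding.encode I ∈ PEDBP.yes → PEDInst.encoding.encode (toPED I) ∈ (PED 3).yes) ∧ (∀ I : PEDBPInst, PEDBPInst.encoding.encode I ∈ PEDBP.no → PEDInst.encoding.encode (toPED I) ∈ (PED 3).no) := by
  refine ⟨fun I hI => ?_, fun I hI => ?_⟩
  · rw [encode_mem_PEDBP_yes_iff] at hI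
    rw [encode_mem_PED_yes_iff]
    refine ⟨degLE_toPED_fst I, degLE_toPED_snd I, ?_⟩
    rw [entropy_toPED_fst, entropy_toPED_snd]
    linarith
  · rw [encode_mem_PEDBP_no_iff] at hI
    rw [encode_mem_PED_no_iff]
    refine ⟨degLE_toPED_fst I, degLE_toPED_snd I, ?_⟩
    rw [entropy_toPED_fst, entropy_toPED_snd]
    linarith

/-! ### The budget of the identity map: blocks have more outputs than fresh variables -/

/-- `|{k < n : i ≤ k}| = n - i`. [folklore] -/
theorem length_filter_le_range (i n : ℕ) :
    ((List.range n).filter fun k => i ≤ k).length = n - i := by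
  induction n with
  | zero => simp
  | succ n ih =>
    rw [List.range_succ, List.filter_append, List.length_append, ih]
    by_cases h : i ≤ n
    · simp [h]; omega
    · simp [h]; omega

/-- The rows of `pairsLE`: `∑_{i < m} (d + 1 - i)` pairs in the first `m` rows. [folklore] -/
theorem length_pairsLE_rows (d m : ℕ) :
    ((List.range m).flatMap fun i =>
      ((List.range (d + 1)).filter fun k => i ≤ k).map fun k => (i, k)).length =
      ∑ i ∈ Finset.range m, (d + 1 - i) := by
  induction m with
  | zero => simp
  | succ m ih =>
    rw [show List.range (m + 1) = List.range m ++ [m] from List.range_succ, List.flatMap_append,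
      List.length_append, ih, Finset.sum_range_succ]
    simp [length_filter_le_range]

/-- `tri (d + 1) = ∑_{i ≤ d} (d + 1 - i)`. [folklore] -/
theorem tri_succ_eq_sum (d : ℕ) : tri (d + 1) = ∑ i ∈ Finset.range (d + 1), (d + 1 - i) := by
  induction d with
  | zero => simp [tri]
  | succ d ih =>
    rw [Finset.sum_range_succ', tri, ih]
    have h : ∀ i, d + 1 + 1 - (i + 1) = d + 1 - i := fun i => by omega
    simp only [h]
    omega

/-- **`pairsLE d` has `(d + 1)(d + 2)/2 = tri (d + 1)` entries.** [folklore] -/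
theorem length_pairsLE (d : ℕ) : (pairsLE d).length = tri (d + 1) := by
  rw [tri_succ_eq_sum]
  exact length_pairsLE_rows d (d + 1)

/-- A block of size `s` has `pos s s + 1 > pos s s` outputs: more outputs than fresh variables.
[folklore] -/
theorem pos_le_length_encodeBDDRaw (n₀ n : ℕ) (B : List (ℕ × ℕ × ℕ × ℕ)) :
    pos (sizeRaw n B) (sizeRaw n B) ≤ (encodeBDDRaw n₀ n B).length := by
  unfold encodeBDDRaw sizeRaw
  cases validRaw n B
  · simp only [Bool.false_eq_true, ite_false, length_gBlock, length_pairsLE, pos, tri]; omega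
  · simp only [ite_true, length_gBlock, length_pairsLE, pos, tri]; omega

/-- **The final counter is at most the start plus the number of outputs**:
`(encodeBDDsRaw n n₀ Bs).1 ≤ n₀ + |(encodeBDDsRaw n n₀ Bs).2|`. [folklore] -/
theorem fst_encodeBDDsRaw_le_length (n : ℕ) : ∀ (n₀ : ℕ) (Bs : List (List (ℕ × ℕ × ℕ × ℕ))),
    (encodeBDDsRaw n n₀ Bs).1 ≤ n₀ + (encodeBDDsRaw n n₀ Bs).2.length
  | n₀, [] => by simp [encodeBDDsRaw]
  | n₀, B :: Bs => by
    simp only [encodeBDDsRaw, List.length_append]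
    have ih := fst_encodeBDDsRaw_le_length n (n₀ + pos (sizeRaw n B) (sizeRaw n B)) Bs
    have hB := pos_le_length_encodeBDDRaw n₀ n B
    omega

/-- The number of random bits `N - n₀` is at most the number of outputs. [folklore] -/
theorem sub_le_length_encodeBDDsRaw (n n₀ : ℕ) (Bs : List (List (ℕ × ℕ × ℕ × ℕ))) :
    (encodeBDDsRaw n n₀ Bs).1 - n₀ ≤ (encodeBDDsRaw n n₀ Bs).2.length := by
  have := fst_encodeBDDsRaw_le_length n n₀ Bs
  omega

/-! ### The typed polynomial-time clause (`stub_toPEDRawFP`) -/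

/-- `prodRaw` on codes (argument `(N, P, Q)`): concatenation and a triple `map` of `N + ·`.
[cite: AroraBarak2009, §1.3] -/
theorem codeFP_prodRaw : CodeFP (pairE natE (pairE (rawE (rawE (rawE natE))) (rawE (rawE (rawE natE)))))
    (rawE (rawE (rawE natE))) (fun p => prodRaw p.1 p.2.1 p.2.2) := by
  have h1 : CodeFP (pairE natE (rawE natE)) (rawE natE) (fun t => t.2.map fun i => t.1 + i) :=
    (CodeFP.map CodeFP.natAdd).congr fun _ => rfl
  have h2 : CodeFP (pairE natE (rawE (rawE natE))) (rawE (rawE natE))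
      (fun t => t.2.map (List.map fun i => t.1 + i)) := (CodeFP.map h1).congr fun _ => rfl
  have h3 : CodeFP (pairE natE (rawE (rawE (rawE natE)))) (rawE (rawE (rawE natE)))
      (fun t => t.2.map (List.map (List.map fun i => t.1 + i))) := (CodeFP.map h2).congr fun _ => rfl
  exact ((CodeFP.rawAppend (rawE (rawE natE))).comp ((CodeFP.snd _ _).fst'.pair
    (h3.comp ((CodeFP.fst _ _).pair (CodeFP.snd _ _).snd')))).congr fun _ => rfl

/-- `idMapRaw` on codes with a unary budget: `(L, m) ↦ idMapRaw (min m |L|)` (the range of a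
binary numeral alone is not polynomial). [cite: AroraBarak2009, §1.3] -/
theorem codeFP_idMapRaw : CodeFP (pairE (rawE (rawE (rawE natE))) natE) (rawE (rawE (rawE natE)))
    (fun p => idMapRaw (min p.2 p.1.length)) :=
  ((CodeFP.map₀ ((CodeFP.rawSingleton (rawE natE)).comp (CodeFP.rawSingleton natE))).comp
    (CodeFP.brange (rawE (rawE natE)))).congr fun _ => rfl

/-- **The raw instance map `toPEDRaw` is typed polynomial time** between the codes of `PEDBP` and
`PED 3` instances, given a typed polynomial-time program for the raw list encoding
`(n, n₀, Bs) ↦ encodeBDDsRaw n n₀ Bs`. [cite: DvirGutfreundRothblumVadhan2010, Thm 4.6] -/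
theorem stub_toPEDRawFP (hA : CodeFP (pairE natE (pairE natE (rawE (rawE (pairE natE (pairE natE (pairE natE natE))))))) (pairE natE (rawE (rawE (rawE natE)))) (fun c => encodeBDDsRaw c.1 c.2.1 c.2.2)) : CodeFP (pairE (pairE natE (listE (listE (pairE natE (pairE natE (pairE natE natE)))))) (pairE natE (listE (listE (pairE natE (pairE natE (pairE natE natE))))))) (pairE (pairE natE (listE (listE (listE natE)))) (pairE natE (listE (listE (listE natE))))) toPEDRaw := by
  let nodeE : ℕ × ℕ × ℕ × ℕ → List Bool := pairE natE (pairE natE (pairE natE natE))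
  let sideE : ℕ × List (List (ℕ × ℕ × ℕ × ℕ)) → List Bool := pairE natE (listE (listE nodeE))
  let inE : (ℕ × List (List (ℕ × ℕ × ℕ × ℕ))) × (ℕ × List (List (ℕ × ℕ × ℕ × ℕ))) → List Bool :=
    pairE sideE sideE
  let P3 : List (List (List ℕ)) → List Bool := rawE (rawE (rawE natE))
  -- (every map whose value mentions `encodeBDDsRaw` is re-targeted by `congr … rfl`: unifying
  -- such targets during elaboration makes the unifier unfold the recursion and time out)
  -- headed → raw programs, raw → headed outputs
  have hraw : CodeFP (listE (listE nodeE)) (rawE (rawE nodeE)) id :=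
    ((CodeFP.map₀ (CodeFP.rawOfList nodeE)).comp (CodeFP.rawOfList (listE nodeE))).congr fun Bs => by
      simp
  have hhead : CodeFP P3 (listE (listE (listE natE))) id :=
    ((CodeFP.listOfRaw (listE (listE natE))).comp (CodeFP.map₀ ((CodeFP.listOfRaw (listE natE)).comp
      (CodeFP.map₀ (CodeFP.listOfRaw natE))))).congr fun P => by simp
  -- the encoding of one side `(n, Bs) ↦ encodeBDDsRaw n n Bs`
  have hargs : CodeFP sideE (pairE natE (pairE natE (rawE (rawE nodeE)))) (fun q => (q.1, q.1, q.2)) :=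
    ((CodeFP.fst _ _).pair ((CodeFP.fst _ _).pair (hraw.comp (CodeFP.snd _ _)))).congr fun _ => rfl
  have hside : CodeFP sideE (pairE natE P3) (fun q => encodeBDDsRaw q.1 q.1 q.2) :=
    (hA.comp hargs).congr fun _ => rfl
  have h1 : CodeFP inE (pairE natE P3) (fun c => encodeBDDsRaw c.1.1 c.1.1 c.1.2) :=
    (hside.comp (CodeFP.fst _ _)).congr fun _ => rfl
  have h2 : CodeFP inE (pairE natE P3) (fun c => encodeBDDsRaw c.2.1 c.2.1 c.2.2) :=
    (hside.comp (CodeFP.snd _ _)).congr fun _ => rfl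
  -- counters, outputs, numbers of random bits of the two sides
  have hN1 : CodeFP inE natE (fun c => (encodeBDDsRaw c.1.1 c.1.1 c.1.2).1) := h1.fst'.congr fun _ => rfl
  have hN2 : CodeFP inE natE (fun c => (encodeBDDsRaw c.2.1 c.2.1 c.2.2).1) := h2.fst'.congr fun _ => rfl
  have hP1 : CodeFP inE P3 (fun c => (encodeBDDsRaw c.1.1 c.1.1 c.1.2).2) := h1.snd'.congr fun _ => rfl
  have hP2 : CodeFP inE P3 (fun c => (encodeBDDsRaw c.2.1 c.2.1 c.2.2).2) := h2.snd'.congr fun _ => rfl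
  have hm1 : CodeFP inE natE (fun c => (encodeBDDsRaw c.1.1 c.1.1 c.1.2).1 - c.1.1) :=
    (CodeFP.natSub.comp (hN1.pair (CodeFP.fst _ _).fst')).congr fun _ => rfl
  have hm2 : CodeFP inE natE (fun c => (encodeBDDsRaw c.2.1 c.2.1 c.2.2).1 - c.2.1) :=
    (CodeFP.natSub.comp (hN2.pair (CodeFP.snd _ _).fst')).congr fun _ => rfl
  -- the identity maps, each with its own side's outputs as budget
  have hid1 : CodeFP inE P3 (fun c => idMapRaw ((encodeBDDsRaw c.1.1 c.1.1 c.1.2).1 - c.1.1)) :=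
    (codeFP_idMapRaw.comp (hP1.pair hm1)).congr fun c => by
      show idMapRaw (min ((encodeBDDsRaw c.1.1 c.1.1 c.1.2).1 - c.1.1)
        (encodeBDDsRaw c.1.1 c.1.1 c.1.2).2.length) = _
      rw [min_eq_left (sub_le_length_encodeBDDsRaw _ _ _)]
  have hid2 : CodeFP inE P3 (fun c => idMapRaw ((encodeBDDsRaw c.2.1 c.2.1 c.2.2).1 - c.2.1)) :=
    (codeFP_idMapRaw.comp (hP2.pair hm2)).congr fun c => by
      show idMapRaw (min ((encodeBDDsRaw c.2.1 c.2.1 c.2.2).1 - c.2.1)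
        (encodeBDDsRaw c.2.1 c.2.1 c.2.2).2.length) = _
      rw [min_eq_left (sub_le_length_encodeBDDsRaw _ _ _)]
  -- the two output sides
  have hout1 : CodeFP inE (pairE natE (listE (listE (listE natE))))
      (fun c => ((encodeBDDsRaw c.1.1 c.1.1 c.1.2).1 + ((encodeBDDsRaw c.2.1 c.2.1 c.2.2).1 - c.2.1),
        prodRaw (encodeBDDsRaw c.1.1 c.1.1 c.1.2).1 (encodeBDDsRaw c.1.1 c.1.1 c.1.2).2
          (idMapRaw ((encodeBDDsRaw c.2.1 c.2.1 c.2.2).1 - c.2.1)))) :=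
    ((CodeFP.natAdd.comp (hN1.pair hm2)).pair
      (hhead.comp (codeFP_prodRaw.comp (hN1.pair (hP1.pair hid2))))).congr fun _ => rfl
  have hout2 : CodeFP inE (pairE natE (listE (listE (listE natE))))
      (fun c => ((encodeBDDsRaw c.2.1 c.2.1 c.2.2).1 + ((encodeBDDsRaw c.1.1 c.1.1 c.1.2).1 - c.1.1),
        prodRaw (encodeBDDsRaw c.2.1 c.2.1 c.2.2).1 (encodeBDDsRaw c.2.1 c.2.1 c.2.2).2
          (idMapRaw ((encodeBDDsRaw c.1.1 c.1.1 c.1.2).1 - c.1.1)))) :=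
    ((CodeFP.natAdd.comp (hN2.pair hm1)).pair
      (hhead.comp (codeFP_prodRaw.comp (hN2.pair (hP2.pair hid1))))).congr fun _ => rfl
  exact (hout1.pair hout2).congr fun _ => rfl

end Summit.PneNP.PneNP.Cruxes.PeaThreeNotInP.SocketBP
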